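import Summits.KontsevichZagierPeriods.KontsevichZagierPeriods.Theorems.LiouvilleUnfoldingAyoubPiCancellationStubStripWeight
import Summits.KontsevichZagierPeriods.KontsevichZagierPeriods.Theorems.LiouvilleUnfoldingAyoubPiCancellationStubStripConst

/-!
# Crux stmt-KontsevichZagierPeriods-0540 (`LiouvilleUnfolding.AyoubPiCancellation` ≡ `KZ.PiCancellation`),
# line `Sketch` (idea `moving-segment-wronskian`): stub `stub_spreadWeight`

Support file (`--supports` stmt-KontsevichZagierPeriods-0540) of the line skeleton (v6), registered
stub `stub_spreadWeight` (S). The ZERO-MEAN SPREAD WEIGHT of an interior interval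
`-1 < a' < b' < 1` (`a' b'` rational),

  `h_{a',b'}(t) = 𝟙_{(a',b')}(t) · ((2t − (a'+b'))(1 − t²) + t (t − a')(t − b')) / (2 (1 − t²) √(1 − t²))`

(the derivative of `(t − a')(t − b') / (2√(1 − t²))` on `(a', b')`, extended by zero), is an
admissible weight for the master theorem `BetaCancellationLine.weightDescent`
(`Theorems/TerasomaMultiplicationBetaCancellationWeightDescent.lean`), exactly like the strip
weight `w_{a,b}` of `stub_stripWeight` (`Theorems/LiouvilleUnfoldingAyoubPiCancellationStubStripWeight.lean`):

* (i) as a function of the single coordinate `x 0` of `ℝ¹` it is `ℚ`-semialgebraic on all of `ℝ¹`: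
  on the `ℚ`-semialgebraic slab `A = {x | a' < x 0 < b'} = KZ.paramSlab 0 a' b'`
  (`KZ.isSemialgebraic_paramSlab`) it is the quotient of a polynomial with rational coefficients
  by `2 (1 − (x 0)²) √(1 − (x 0)²)`, a product of `ℚ`-semialgebraic functions which does not
  vanish there (`1 − (x 0)² > 0`; Bochnak–Coste–Roy Prop. 2.2.6: products, square roots and
  inverses of real semialgebraic functions are semialgebraic), and it is extended by zero off `A`
  (`IsSemialgebraicFunOn.indicator`);
* (ii) it is bounded: the profile is continuous on the compact interval `[a', b']` (the
  denominator does not vanish there since `-1 < a' ≤ t ≤ b' < 1`), hence bounded there, and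
  `h_{a',b'} = 0` off `(a', b')`.

No definitions; namespace of the line skeleton. References: J. Bochnak, M. Coste, M.-F. Roy,
*Real Algebraic Geometry* (1998), §2.2, Prop. 2.2.6; M. Kontsevich, D. Zagier, *Periods* (2001), §1.1.
-/

noncomputable section

-- `Summit.KontsevichZagierPeriods.KontsevichZagierPeriods.…` is the tree's mandated layout (single-conjunct summit).
set_option linter.dupNamespace false

namespace Summit.KontsevichZagierPeriods.KontsevichZagierPeriods.AyoubPiCancellationLine

open Set MeasureTheory
open Literature.NumberTheory.Transcendental
open Literature.NumberTheory.Transcendental.KZ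
open Literature.ModelTheory.ExponentialFields (IsSemialgebraic isSemialgebraic_univ)
open MvPolynomial (X C)

-- adapted from Summits/KontsevichZagierPeriods/KontsevichZagierPeriods/Theorems/LiouvilleUnfoldingAyoubPiCancellationStubStripWeight.lean
-- (atoms by `isSemialgebraicFunOn_aeval` + dot-chain `.sqrt_holds` / `.mul_holds` / `.div` + `congr`;
-- the bound by compactness of `[a', b']`)

/-! ## (i) Semialgebraicity -/

/-- On the slab `KZ.paramSlab 0 a' b' = {a' < x 0 < b'}` of an interior interval the profile
`x ↦ ((2 x₀ − (a'+b'))(1 − x₀²) + x₀ (x₀ − a')(x₀ − b')) / (2 (1 − x₀²) √(1 − x₀²))` (`x₀ = x 0`) is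
`ℚ`-semialgebraic: a quotient of real semialgebraic functions with non-vanishing denominator
(Bochnak–Coste–Roy Prop. 2.2.6). [folklore] -/
theorem spreadWeight_isSemialgebraicFunOn_slab {a' b' : ℚ} (ha : -1 < a') (hb : b' < 1) :
    IsSemialgebraicFunOn ℚ (paramSlab 0 a' b') (fun x => ((2 * x 0 - (a' + b')) * (1 - x 0 ^ 2) +
      x 0 * ((x 0 - a') * (x 0 - b'))) / (2 * (1 - x 0 ^ 2) * Real.sqrt (1 - x 0 ^ 2))) := by
  have hA : IsSemialgebraic ℚ (paramSlab 0 a' b') := isSemialgebraic_paramSlab 0 a' b'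
  have hnum : IsSemialgebraicFunOn ℚ (paramSlab 0 a' b') (fun x => (2 * x 0 - (a' + b')) * (1 - x 0 ^ 2) +
      x 0 * ((x 0 - a') * (x 0 - b'))) :=
    (isSemialgebraicFunOn_aeval hA ((2 * X 0 - (C a' + C b')) * (1 - X 0 ^ 2) +
      X 0 * ((X 0 - C a') * (X 0 - C b')) : MvPolynomial (Fin 1) ℚ)).congr fun x _ => by simp
  have hpol : IsSemialgebraicFunOn ℚ (paramSlab 0 a' b') (fun x => 2 * (1 - x 0 ^ 2)) :=
    (isSemialgebraicFunOn_aeval hA (2 * (1 - X 0 ^ 2) : MvPolynomial (Fin 1) ℚ)).congr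
      fun x _ => by simp
  have hsqrt : IsSemialgebraicFunOn ℚ (paramSlab 0 a' b') (fun x => Real.sqrt (1 - x 0 ^ 2)) :=
    (IsSemialgebraicFunOn.sqrt_holds (isSemialgebraicFunOn_aeval hA
      (1 - X 0 ^ 2 : MvPolynomial (Fin 1) ℚ))).congr fun x _ => by simp
  have hden : IsSemialgebraicFunOn ℚ (paramSlab 0 a' b')
      (fun x => 2 * (1 - x 0 ^ 2) * Real.sqrt (1 - x 0 ^ 2)) :=
    (IsSemialgebraicFunOn.mul_holds hpol hsqrt).congr fun x _ => by simp
  refine IsSemialgebraicFunOn.div hnum hden fun x hx => ?_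
  rw [mem_paramSlab] at hx
  have hpos : 0 < 1 - x 0 ^ 2 := stripWeight_radicand_pos ha hb hx.1 hx.2
  exact mul_ne_zero (mul_ne_zero two_ne_zero hpos.ne') (Real.sqrt_pos.mpr hpos).ne'

/-- **(i)** The spread weight `h_{a',b'}(x 0)` of an interior interval is `ℚ`-semialgebraic on all
of `ℝ¹` (extension by zero of a semialgebraic function off a semialgebraic set). [folklore] -/
theorem spreadWeight_isSemialgebraicFunOn {a' b' : ℚ} (ha : -1 < a') (hb : b' < 1) :
    IsSemialgebraicFunOn ℚ (Set.univ : Set (Fin 1 → ℝ))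
      (fun x => (Set.Ioo (a' : ℝ) b').indicator (fun t => ((2 * t - (a' + b')) * (1 - t ^ 2) +
        t * ((t - a') * (t - b'))) / (2 * (1 - t ^ 2) * Real.sqrt (1 - t ^ 2))) (x 0)) := by
  have h : IsSemialgebraicFunOn ℚ (Set.univ : Set (Fin 1 → ℝ))
      ((paramSlab 0 a' b').indicator (fun x => ((2 * x 0 - (a' + b')) * (1 - x 0 ^ 2) +
        x 0 * ((x 0 - a') * (x 0 - b'))) / (2 * (1 - x 0 ^ 2) * Real.sqrt (1 - x 0 ^ 2)))) :=
    IsSemialgebraicFunOn.indicator isSemialgebraic_univ (isSemialgebraic_paramSlab 0 a' b')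
      ((spreadWeight_isSemialgebraicFunOn_slab ha hb).mono inter_subset_right
        (isSemialgebraic_univ.inter (isSemialgebraic_paramSlab 0 a' b')))
  exact h.congr fun x _ => (stripConst_indicator_apply a' b'
    (fun t => ((2 * t - (a' + b')) * (1 - t ^ 2) + t * ((t - a') * (t - b'))) /
      (2 * (1 - t ^ 2) * Real.sqrt (1 - t ^ 2))) x).symm

/-! ## (ii) Boundedness -/

/-- The profile `t ↦ ((2t − (a'+b'))(1 − t²) + t (t − a')(t − b')) / (2 (1 − t²) √(1 − t²))` is
continuous on the compact interval `[a', b']` of an interior interval `-1 < a' ≤ b' < 1` (the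
denominator does not vanish there). [folklore] -/
theorem spreadWeight_continuousOn {a' b' : ℚ} (ha : -1 < a') (hb : b' < 1) :
    ContinuousOn (fun t : ℝ => ((2 * t - (a' + b')) * (1 - t ^ 2) + t * ((t - a') * (t - b'))) /
      (2 * (1 - t ^ 2) * Real.sqrt (1 - t ^ 2))) (Icc (a' : ℝ) b') := by
  refine ContinuousOn.div (by fun_prop) (by fun_prop) fun t ht => ?_
  have ha' : (-1 : ℝ) < (a' : ℝ) := by exact_mod_cast ha
  have hb' : ((b' : ℚ) : ℝ) < 1 := by exact_mod_cast hb
  have h1 : -1 < t := by linarith [ht.1]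
  have h2 : t < 1 := by linarith [ht.2]
  have hpos : 0 < 1 - t ^ 2 := by nlinarith
  exact mul_ne_zero (mul_ne_zero two_ne_zero hpos.ne') (Real.sqrt_pos.mpr hpos).ne'

/-- **(ii)** The spread weight of an interior interval is bounded: the profile is bounded on the
compact interval `[a', b'] ⊇ (a', b')`, and the weight vanishes off `(a', b')`. [folklore] -/
theorem spreadWeight_exists_bound {a' b' : ℚ} (ha : -1 < a') (hb : b' < 1) :
    ∃ C : ℝ, ∀ t : ℝ, |(Set.Ioo (a' : ℝ) b').indicator (fun t => ((2 * t - (a' + b')) * (1 - t ^ 2) +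
      t * ((t - a') * (t - b'))) / (2 * (1 - t ^ 2) * Real.sqrt (1 - t ^ 2))) t| ≤ C := by
  obtain ⟨C, hC⟩ := isCompact_Icc.exists_bound_of_continuousOn (spreadWeight_continuousOn ha hb)
  refine ⟨max C 0, fun t => ?_⟩
  by_cases ht : t ∈ Set.Ioo (a' : ℝ) b'
  · rw [indicator_of_mem ht]
    have h := hC t (Ioo_subset_Icc_self ht)
    rw [Real.norm_eq_abs] at h
    exact h.trans (le_max_left _ _)
  · rw [indicator_of_notMem ht, abs_zero]
    exact le_max_right _ _

/-! ## The stub -/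

/-- STUB `stub_spreadWeight` (S) of the line `Sketch` — **admissibility of the zero-mean spread
weight**: for an interior interval `-1 < a' < b' < 1` the weight
`h_{a',b'}(t) = 𝟙_{(a',b')}(t) · ((2t − (a'+b'))(1 − t²) + t (t − a')(t − b')) / (2 (1 − t²) √(1 − t²))`
(the derivative of `(t − a')(t − b') / (2√(1 − t²))` on `(a', b')`, extended by zero) is
`ℚ`-semialgebraic as a function of `x 0` on `ℝ¹` and bounded. [folklore] -/
theorem stub_spreadWeight : ∀ (a' b' : ℚ), -1 < a' → a' < b' → b' < 1 →
    IsSemialgebraicFunOn ℚ (Set.univ : Set (Fin 1 → ℝ))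
        (fun x => (Set.Ioo (a' : ℝ) b').indicator (fun t => ((2 * t - (a' + b')) * (1 - t ^ 2) +
          t * ((t - a') * (t - b'))) / (2 * (1 - t ^ 2) * Real.sqrt (1 - t ^ 2))) (x 0)) ∧
      ∃ C : ℝ, ∀ t : ℝ, |(Set.Ioo (a' : ℝ) b').indicator (fun t => ((2 * t - (a' + b')) * (1 - t ^ 2) +
          t * ((t - a') * (t - b'))) / (2 * (1 - t ^ 2) * Real.sqrt (1 - t ^ 2))) t| ≤ C :=
  fun _ _ ha _ hb => ⟨spreadWeight_isSemialgebraicFunOn ha hb, spreadWeight_exists_bound ha hb⟩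

end Summit.KontsevichZagierPeriods.KontsevichZagierPeriods.AyoubPiCancellationLine
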